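import Mathlib
import Summits.MatrixMultiplication.MatrixMultiplication.Theorems.ThinPackings.Negative.TriageRuledGraphPatternedArc
import Summits.MatrixMultiplication.MatrixMultiplication.Theorems.ThinBlockAlphaThinPackingsStubGradedFrames

set_option linter.dupNamespace false

/-!
# `ThinPackings`, line `label-weighted-stpp-debordering`: `stub_generalBridge`
(order-compatible orthogonal frames on spheres are label-weighted)

Crux `stmt-MatrixMultiplication-10595` (`Summit.…Theses.ThinBlockAlpha.ThinPackings`), line
`label-weighted-stpp-debordering`, registered stub `stub_generalBridge` (lead's reshape v3, adopting the
drefuter's sharpening of 2026-08-16T04:47Z).  Blocks are ORTHOGONAL FRAMES in `ℤ^D` on spheres of ARBITRARY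
per-block squared radii `rA i`, `rB i`, `rC i`; the potentials `κ, μ` are ORDER-COMPATIBLE: `κ` increases by
integer steps along the pair radius `E = rA + rB`, `μ` along `F = rB + rC`, and `κ + μ` decreases along the
tile radius `T = rA + rC`.  Then the label-weighted STPP (`Triage2.IsLabelWeightedSTPP A B C κ μ`) is
EQUIVALENT to the three packings plus the all-distinct-label clause restricted to the triples of non-positive
weight `(κ i − κ k) + (μ j − μ k) ≤ 0`.  One Pythagoras step per two-label pattern: `(i,i,k)` raises `T`
strictly (else a `C − A` collision), `(i,k,k)` raises `E` (else a `B − A` collision), `(i,j,i)` raises `F`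
(else a `B − C` collision); order-compatibility turns the strict raise into weight `≥ 1`.  The affine grading
of `stub_gradedFrames` (p79783) is the special case `rA = xA + α d`, `rB = xB − β d`, `rC = xC + γ d`,
`κ = μ = −d`.  Helpers `GradedFrames.norm_transfer`, `one_le_normSq`, `eq_zero_of_orth_sum`,
`sub_dotProduct_sub_eq_zero` are reused from that file.
-/

namespace Summit.MatrixMultiplication.MatrixMultiplication.Theorems.ThinPackings

open Finset
open Literature.Computability.AlgebraicComplexity (IsSTPP)
open Summit.MatrixMultiplication.MatrixMultiplication.Theorems.ThinPackings.Negative.Triage2 (IsLabelWeightedSTPP)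

/-- Pattern `(i, i, k)` with `i ≠ k`, general radii: a relation `(s' - s) + (t' - t) + (u' - u) = 0` with
`s ∈ A k`, `s', t, t', u` in block `i`, `u' ∈ C k` forces the tile radius to rise strictly,
`rA i + rC i < rA k + rC k` (`‖u' − s‖² = ‖u − s'‖² + ‖t − t'‖²`, and `t = t'` would be a `C − A` collision). -/
theorem GeneralFrames.case_iik {D L : ℕ} {A B C : Fin L → Finset (Fin D → ℤ)} {rA rC : Fin L → ℤ}
    (hAB : ∀ i, ∀ x ∈ A i, ∀ y ∈ B i, x ⬝ᵥ y = 0) (hAC : ∀ i, ∀ x ∈ A i, ∀ z ∈ C i, x ⬝ᵥ z = 0)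
    (hBC : ∀ i, ∀ y ∈ B i, ∀ z ∈ C i, y ⬝ᵥ z = 0)
    (hnA : ∀ i, ∀ x ∈ A i, x ⬝ᵥ x = rA i) (hnC : ∀ i, ∀ z ∈ C i, z ⬝ᵥ z = rC i)
    (R1 : ∀ i k, ∀ a ∈ A i, ∀ c ∈ C i, ∀ a' ∈ A k, ∀ c' ∈ C k,
      c - a = c' - a' → i = k ∧ a = a' ∧ c = c')
    {i k : Fin L} (hik : i ≠ k) {s s' t t' u u' : Fin D → ℤ} (hs : s ∈ A k) (hs' : s' ∈ A i)
    (ht : t ∈ B i) (ht' : t' ∈ B i) (hu : u ∈ C i) (hu' : u' ∈ C k)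
    (hrel : (s' - s) + (t' - t) + (u' - u) = 0) : rA i + rC i < rA k + rC k := by
  have hvec : u' - s = (u - s') + (t - t') := by
    have e : u' - s = (u - s') + (t - t') + ((s' - s) + (t' - t) + (u' - u)) := by abel
    rw [e, hrel, add_zero]
  have key := GradedFrames.norm_transfer (by rw [dotProduct_comm]; exact hAC k s hs u' hu')
    (by rw [dotProduct_comm]; exact hAC i s' hs' u hu)
    (by rw [dotProduct_comm]; exact hBC i t ht u hu)
    (by rw [dotProduct_comm]; exact hBC i t' ht' u hu) (hAB i s' hs' t ht) (hAB i s' hs' t' ht')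
    hvec
  rw [hnC k u' hu', hnA k s hs, hnC i u hu, hnA i s' hs'] at key
  by_cases htt : t = t'
  · subst htt
    have hcol : u - s' = u' - s := by rw [hvec, sub_self, add_zero]
    exact absurd (R1 i k s' hs' u hu s hs u' hu' hcol).1 hik
  · have hN := GradedFrames.one_le_normSq (sub_ne_zero.mpr htt)
    linarith

/-- Pattern `(i, k, k)` with `i ≠ k`, general radii: a relation with `s' ∈ A i`, `t ∈ B i` and `s, t', u, u'`
in block `k` forces `rA k + rB k < rA i + rB i` (`‖t − s'‖² = ‖t' − s‖² + ‖u' − u‖²`, and `u = u'` would be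
a `B − A` collision). -/
theorem GeneralFrames.case_ijj {D L : ℕ} {A B C : Fin L → Finset (Fin D → ℤ)} {rA rB : Fin L → ℤ}
    (hAB : ∀ i, ∀ x ∈ A i, ∀ y ∈ B i, x ⬝ᵥ y = 0) (hAC : ∀ i, ∀ x ∈ A i, ∀ z ∈ C i, x ⬝ᵥ z = 0)
    (hBC : ∀ i, ∀ y ∈ B i, ∀ z ∈ C i, y ⬝ᵥ z = 0)
    (hnA : ∀ i, ∀ x ∈ A i, x ⬝ᵥ x = rA i) (hnB : ∀ i, ∀ y ∈ B i, y ⬝ᵥ y = rB i)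
    (R2 : ∀ i k, ∀ a ∈ A i, ∀ b ∈ B i, ∀ a' ∈ A k, ∀ b' ∈ B k,
      b - a = b' - a' → i = k ∧ a = a' ∧ b = b')
    {i k : Fin L} (hik : i ≠ k) {s s' t t' u u' : Fin D → ℤ} (hs : s ∈ A k) (hs' : s' ∈ A i)
    (ht : t ∈ B i) (ht' : t' ∈ B k) (hu : u ∈ C k) (hu' : u' ∈ C k)
    (hrel : (s' - s) + (t' - t) + (u' - u) = 0) : rA k + rB k < rA i + rB i := by
  have hvec : t - s' = (t' - s) + (u' - u) := by
    have e : t - s' = (t' - s) + (u' - u) - ((s' - s) + (t' - t) + (u' - u)) := by abel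
    rw [e, hrel, sub_zero]
  have key := GradedFrames.norm_transfer (by rw [dotProduct_comm]; exact hAB i s' hs' t ht)
    (by rw [dotProduct_comm]; exact hAB k s hs t' ht') (hBC k t' ht' u' hu') (hBC k t' ht' u hu)
    (hAC k s hs u' hu') (hAC k s hs u hu) hvec
  rw [hnB i t ht, hnA i s' hs', hnB k t' ht', hnA k s hs] at key
  by_cases huu : u' = u
  · subst huu
    have hcol : t - s' = t' - s := by rw [hvec, sub_self, add_zero]
    exact absurd (R2 i k s' hs' t ht s hs t' ht' hcol).1 hik
  · have hN := GradedFrames.one_le_normSq (sub_ne_zero.mpr huu)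
    linarith

/-- Pattern `(i, j, i)` with `i ≠ j`, general radii: a relation with `s, s', t, u'` in block `i` and
`t' ∈ B j`, `u ∈ C j` forces `rB i + rC i < rB j + rC j` (`‖t' − u‖² = ‖t − u'‖² + ‖s − s'‖²`, and `s = s'`
would be a `B − C` collision). -/
theorem GeneralFrames.case_iji {D L : ℕ} {A B C : Fin L → Finset (Fin D → ℤ)} {rB rC : Fin L → ℤ}
    (hAB : ∀ i, ∀ x ∈ A i, ∀ y ∈ B i, x ⬝ᵥ y = 0) (hAC : ∀ i, ∀ x ∈ A i, ∀ z ∈ C i, x ⬝ᵥ z = 0)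
    (hBC : ∀ i, ∀ y ∈ B i, ∀ z ∈ C i, y ⬝ᵥ z = 0)
    (hnB : ∀ i, ∀ y ∈ B i, y ⬝ᵥ y = rB i) (hnC : ∀ i, ∀ z ∈ C i, z ⬝ᵥ z = rC i)
    (R3 : ∀ i k, ∀ b ∈ B i, ∀ c ∈ C i, ∀ b' ∈ B k, ∀ c' ∈ C k,
      b - c = b' - c' → i = k ∧ b = b' ∧ c = c')
    {i j : Fin L} (hij : i ≠ j) {s s' t t' u u' : Fin D → ℤ} (hs : s ∈ A i) (hs' : s' ∈ A i)
    (ht : t ∈ B i) (ht' : t' ∈ B j) (hu : u ∈ C j) (hu' : u' ∈ C i)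
    (hrel : (s' - s) + (t' - t) + (u' - u) = 0) : rB i + rC i < rB j + rC j := by
  have hvec : t' - u = (t - u') + (s - s') := by
    have e : t' - u = (t - u') + (s - s') + ((s' - s) + (t' - t) + (u' - u)) := by abel
    rw [e, hrel, add_zero]
  have key := GradedFrames.norm_transfer (hBC j t' ht' u hu) (hBC i t ht u' hu')
    (by rw [dotProduct_comm]; exact hAB i s hs t ht)
    (by rw [dotProduct_comm]; exact hAB i s' hs' t ht)
    (by rw [dotProduct_comm]; exact hAC i s hs u' hu')
    (by rw [dotProduct_comm]; exact hAC i s' hs' u' hu') hvec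
  rw [hnB j t' ht', hnC j u hu, hnB i t ht, hnC i u' hu'] at key
  by_cases hss : s = s'
  · subst hss
    have hcol : t - u' = t' - u := by rw [hvec, sub_self, add_zero]
    exact absurd (R3 i j t ht u' hu' t' ht' u hu hcol).1 hij
  · have hN := GradedFrames.one_le_normSq (sub_ne_zero.mpr hss)
    linarith

/-- **stub_generalBridge** — ORDER-COMPATIBLE FRAMES ARE WEIGHTED.  For an orthogonal frame family in `ℤ^D` on
spheres of arbitrary per-block squared radii `rA i, rB i, rC i` and potentials `κ, μ` with
`E k < E i ⇒ κ k + 1 ≤ κ i` (`E = rA + rB`), `F k < F i ⇒ μ k + 1 ≤ μ i` (`F = rB + rC`) and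
`T i < T k ⇒ κ k + μ k + 1 ≤ κ i + μ i` (`T = rA + rC`), the label-weighted STPP `IsLabelWeightedSTPP A B C κ μ`
is equivalent to the three packings together with the all-distinct-label clause restricted to the triples of
non-positive weight `(κ i − κ k) + (μ j − μ k) ≤ 0`.  The bridge of line `label-weighted-stpp-debordering`
(reshape v3) to frame designs; contains `stub_gradedFrames` (affine grading, `κ = μ = −d`).
[new, elementary: Pythagoras + integrality of squared norms] -/
theorem stub_generalBridge :
    ∀ (D L : ℕ) (A B C : Fin L → Finset (Fin D → ℤ)) (rA rB rC κ μ : Fin L → ℤ),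
      ((∀ i, ∀ x ∈ A i, ∀ y ∈ B i, x ⬝ᵥ y = 0) ∧ (∀ i, ∀ x ∈ A i, ∀ z ∈ C i, x ⬝ᵥ z = 0) ∧
        (∀ i, ∀ y ∈ B i, ∀ z ∈ C i, y ⬝ᵥ z = 0)) →
      ((∀ i, ∀ x ∈ A i, x ⬝ᵥ x = rA i) ∧ (∀ i, ∀ y ∈ B i, y ⬝ᵥ y = rB i) ∧
        (∀ i, ∀ z ∈ C i, z ⬝ᵥ z = rC i)) →
      ((∀ i k, rA k + rB k < rA i + rB i → κ k + 1 ≤ κ i) ∧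
        (∀ i k, rB k + rC k < rB i + rC i → μ k + 1 ≤ μ i) ∧
        (∀ i k, rA i + rC i < rA k + rC k → κ k + μ k + 1 ≤ κ i + μ i)) →
      (IsLabelWeightedSTPP A B C κ μ ↔
        ((∀ i k, ∀ a ∈ A i, ∀ c ∈ C i, ∀ a' ∈ A k, ∀ c' ∈ C k, c - a = c' - a' → i = k ∧ a = a' ∧ c = c') ∧
         (∀ i k, ∀ a ∈ A i, ∀ b ∈ B i, ∀ a' ∈ A k, ∀ b' ∈ B k, b - a = b' - a' → i = k ∧ a = a' ∧ b = b') ∧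
         (∀ i k, ∀ b ∈ B i, ∀ c ∈ C i, ∀ b' ∈ B k, ∀ c' ∈ C k, b - c = b' - c' → i = k ∧ b = b' ∧ c = c') ∧
         (∀ i j k : Fin L, i ≠ j → j ≠ k → i ≠ k → (κ i - κ k) + (μ j - μ k) ≤ 0 →
            ∀ s ∈ A k, ∀ s' ∈ A i, ∀ t ∈ B i, ∀ t' ∈ B j, ∀ u ∈ C j, ∀ u' ∈ C k,
              (s' - s) + (t' - t) + (u' - u) ≠ 0))) := by
  intro D L A B C rA rB rC κ μ horth hnorm hoc
  obtain ⟨hAB, hAC, hBC⟩ := horth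
  obtain ⟨hnA, hnB, hnC⟩ := hnorm
  obtain ⟨hE, hF, hT⟩ := hoc
  constructor
  · rintro ⟨h1, h2, h3, -, h5⟩
    refine ⟨?_, ?_, h2, ?_⟩
    · intro i k a ha c hc a' ha' c' hc' h
      obtain ⟨hik, hcc, haa⟩ := h3 i k c hc a ha c' hc' a' ha' h
      exact ⟨hik, haa, hcc⟩
    · intro i k a ha b hb a' ha' b' hb' h
      exact h1 i k a ha b hb a' ha' b' hb' (by rw [← neg_sub, h, neg_sub])
    · intro i j k hij _hjk _hik hw s hs s' hs' t ht t' ht' u hu u' hu' hrel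
      have hw1 : 1 ≤ (κ i - κ k) + (μ j - μ k) :=
        h5 i j k (fun h => hij h.1) s hs s' hs' t ht t' ht' u hu u' hu' hrel
      linarith
  · rintro ⟨R1, R2, R3, R4⟩
    refine ⟨?_, R3, ?_, ?_, ?_⟩
    · intro i k s hs t ht s' hs' t' ht' h
      exact R2 i k s hs t ht s' hs' t' ht' (by rw [← neg_sub, h, neg_sub])
    · intro i k u hu s hs u' hu' s' hs' h
      obtain ⟨hik, hss, huu⟩ := R1 i k s hs u hu s' hs' u' hu' h
      exact ⟨hik, huu, hss⟩
    · intro i s hs s' hs' t ht t' ht' u hu u' hu' hrel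
      obtain ⟨hp, hq, hr⟩ := GradedFrames.eq_zero_of_orth_sum
        (GradedFrames.sub_dotProduct_sub_eq_zero (hAB i s hs t ht) (hAB i s hs t' ht')
          (hAB i s' hs' t ht) (hAB i s' hs' t' ht'))
        (GradedFrames.sub_dotProduct_sub_eq_zero (hAC i s hs u hu) (hAC i s hs u' hu')
          (hAC i s' hs' u hu) (hAC i s' hs' u' hu'))
        (GradedFrames.sub_dotProduct_sub_eq_zero (hBC i t ht u hu) (hBC i t ht u' hu')
          (hBC i t' ht' u hu) (hBC i t' ht' u' hu')) hrel
      exact ⟨(sub_eq_zero.mp hp).symm, (sub_eq_zero.mp hq).symm, (sub_eq_zero.mp hr).symm⟩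
    · intro i j k hne s hs s' hs' t ht t' ht' u hu u' hu' hrel
      by_cases hij : i = j
      · subst hij
        have key := GeneralFrames.case_iik hAB hAC hBC hnA hnC R1 (fun h => hne ⟨rfl, h⟩)
          hs hs' ht ht' hu hu' hrel
        have := hT i k key
        linarith
      · by_cases hjk : j = k
        · subst hjk
          have key := GeneralFrames.case_ijj hAB hAC hBC hnA hnB R2 hij hs hs' ht ht' hu hu' hrel
          have := hE i j key
          linarith
        · by_cases hik : i = k
          · subst hik
            have key := GeneralFrames.case_iji hAB hAC hBC hnB hnC R3 hij hs hs' ht ht' hu hu' hrel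
            have := hF j i key
            linarith
          · by_cases hw : (κ i - κ k) + (μ j - μ k) ≤ 0
            · exact absurd hrel (R4 i j k hij hjk hik hw s hs s' hs' t ht t' ht' u hu u' hu')
            · omega

end Summit.MatrixMultiplication.MatrixMultiplication.Theorems.ThinPackings
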